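import Summits.BirchSwinnertonDyer.Rank1Residual.ManinAdditive.RamifiedTwistOptimalityCommutesProof
import Summits.BirchSwinnertonDyer.Rank1Residual.Additive.GordTwistMinimalModel
import Summits.BirchSwinnertonDyer.Rank1Residual.Additive.GordIsogenyInvarianceClasses
import Summits.BirchSwinnertonDyer.Rank1Residual.AdditivePotMult.PStarTwistModel
import Summits.BirchSwinnertonDyer.Rank1Residual.AdditivePotMult.Twist
import Summits.BirchSwinnertonDyer.Rank1Residual.ManinAdditive.TwistOrbitDegreeIdentity
import Literature.NumberTheory.EllipticCurves.ManinConstantKodairaTypePrimes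
import Literature.NumberTheory.DiophantineGeometry.TateAlgorithmTameTypesOddProofs
import HarnessLib

/-!
# Route `ManinLocalTwoThree`, residual crux C5 `ManinPrimeToAdditiveFiveLe`
# (stmt-BirchSwinnertonDyer-22969), line `upper_anchor`: STUB 3 `stub_upperAnchor`
# **CLOSED MODULO two named statements** — Edixhoven 1991 Thm. 3 (cite-only Literature fact) at
# `p > 7`, crux K★ `StarredOptimalManinUnitFiveSeven` (stmt-BirchSwinnertonDyer-22226) at `p ∈ {5, 7}`

The registered stub `stub_upperAnchor` of the line skeleton
`Cruxes/ManinPrimeToAdditiveFiveLe/Lines/upper_anchor.lean` (sha16 b6313bd2b9b9b148) says: for a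
commuting optimal `χ_{p*}`-pair `u • (W ⊗ χ_{p*}) = W'` of globally minimal curves at a common
conductor `N`, `p ≥ 5`, `p² ∣ N`, both data lattice-optimal at the conductor level, `W[p]`
irreducible, with `W'` the UPPER member (`ord_p Δ_min(W') = ord_p Δ_min(W) + 6`), one has
`p ∤ c(D')`. The line card prices it «Edixhoven Thm 3 PORT at `p ≥ 11`, = K★ stmt-22226 at
`p ∈ {5,7}`» (critic VERDICT #1 (P3)). This file proves EXACTLY that pricing, kernel-checked:

* §1 (unconditional, the geometric content): along a commuting `χ_{p*}`-pair with BOTH members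
  additive at the odd prime `p`, the curve is potentially GOOD at `p` (`0 ≤ ord_p j`,
  `padicValRat_j_nonneg_of_pStar_pair_addv`) — a potentially multiplicative additive curve untwists
  to a MULTIPLICATIVE one over `ℚ(√p*)` (the cell's `AdditivePotMult.PotMult.mult_quadraticTwist_pStar`,
  Silverman *ATAEC* V.5.3), contradicting the additivity of the partner; hence the upper member has
  NO `Iₙ*` fibre at `p` (`kodairaSymbolAt_ne_Istar_of_upper`: `Iₙ*`, `n ≥ 1`, has `ord_p j < 0`;
  `I₀*` would force `ord_p Δ_min(W) = 0`) and is of STARRED type IV*, III*, II* with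
  `ord_p Δ_min(W') ∈ {8, 9, 10}` (`kodairaSymbolAt_upper_starred`, Silverman *ATAEC* IV Table 4.1
  via the cell's dictionary `kodairaSymbolAt_placeOf_cases_of_addv`).
* §2 `upperAnchor_of_edixhovenKodairaFact`: at `p > 7` the stub follows from the cite-only fact
  `edixhoven_not_dvd_maninConstant_of_kodairaSymbol_ne` (Edixhoven 1991 Thm. 3, Kodaira-type half:
  strong parametrisation, `p > 7`, type not II/III/IV ⇒ `p ∤ c`), applied to `(W', D')`.
* §3 `upperAnchor_fiveSeven_of_starred`: at `p ∈ {5, 7}` the stub follows from crux K★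
  `Theses.EdixhovenFibreFiveSeven.StarredOptimalManinUnitFiveSeven` (stmt-22226; its body verbatim as
  the hypothesis `hK`) — the upper
  member meets every K★ hypothesis (additive, `W'[p]` irreducible by twist/isomorphism invariance,
  no `Iₙ*` fibre by §1, `4 < ord_p Δ_min(W')`, lattice-optimal conductor-level datum).
* §4 `upperAnchor_of_edixhovenKodairaFact_of_starred`: the registered signature VERBATIM (all
  `p ≥ 5`) from (i) + (ii), with (ii) = the BODY of K★ as a hypothesis (this file imports no route
  file; the companion `ManinLocalTwoThreeManinPrimeToAdditiveFiveLeUpperAnchorOfKStar` feeds it K★ BY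
  NAME and, through the landed `starredOptimalManinUnitFiveSeven_of_kato` (p581141), Kato's
  cite-only Néron-integrality fact).

HONEST STATUS. Conditional-result (`--supports`, not a closure): the registered stub stays `sorry`
in the skeleton because crux C5 carries only the printed semistable facts and modularity as
hypotheses — inside C5-as-typed, input (i) is a re-proof of Edixhoven's theorem (integral models of
`X₀(N)`, Raynaud's `e < p − 1`; XL) and input (ii) is open at `(5, II*)` (`e = 6 > p − 1`). What this
file settles is that NOTHING ELSE is needed for stub 3: its entire open content is {Edixhoven
Thm. 3 as printed} ∪ {K★}. Nothing here proves BSD, Manin's conjecture or C5.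
Seat bsd-line-ml23-c5-p1-w2 (width prover; allocation by lead bsd-line-ml23-c5-p1, 05:19Z).

References: [EdixhovenManin1991] Thm. 3, Props. 7–8, §1; [SilvermanATAEC1994] IV.9.4, Table 4.1,
V.5.3; [SilvermanAEC2009] VII.5, X.5.4; [Kato2004Asterisque] (8.1.3), Thm. 9.7;
[KostersPannekoek2017] Thm. 1; [AgasheRibetStein2006] Thm. 2.2.
-/

set_option autoImplicit false
-- the Theorems namespace of this sub repeats the summit name by design (D-0017 nested layout)
set_option linter.dupNamespace false

noncomputable section

open scoped Classical

namespace Summit.BirchSwinnertonDyer.BirchSwinnertonDyer.Theorems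

open WeierstrassCurve IsDedekindDomain Rat.HeightOneSpectrum
  Literature.NumberTheory.EllipticCurves Literature.NumberTheory.EllipticCurves.ModularForms
  Literature.NumberTheory.EllipticCurves.Rank1Residual
  Literature.NumberTheory.DiophantineGeometry
  Summit.BirchSwinnertonDyer.Rank1Residual
  Summit.BirchSwinnertonDyer.Rank1Residual.ManinAdditive
  Summit.BirchSwinnertonDyer.Rank1Residual.Additive

/-! ## §1 A commuting `χ_{p*}`-pair with both members additive at `p` is potentially good -/

/-- The cell's rational `p*` and the route's integer-cast `p*` agree: `((−1)^{⌊p/2⌋} p : ℤ) = (−1)^{⌊p/2⌋} p`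
in `ℚ`. [folklore] -/
theorem upperAnchor_pStar_cast (p : ℕ) :
    ((((-1 : ℤ) ^ (p / 2) * p : ℤ)) : ℚ) = (-1 : ℚ) ^ (p / 2) * p := by
  push_cast; ring

/-- **No commuting `χ_{p*}`-pair with both members additive at the odd prime `p` is potentially
multiplicative.** If `u • (W ⊗ χ_{p*}) = W'` with `W` and `W'` both additive at `p`, then
`0 ≤ ord_p j(W)`: otherwise `W` is additive potentially multiplicative at `p`, and then `W ⊗ χ_{p*}`
— hence its `ℚ`-model `W'` — is MULTIPLICATIVE at `p` (the cell's kernel theorem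
`AdditivePotMult.PotMult.mult_quadraticTwist_pStar`: a ramified quadratic twist of a Tate curve
untwists over `ℚ_p(√p*)`; Silverman *ATAEC* V.5.3), contradicting the additivity of `W'`.
[cite: SilvermanATAEC1994, V.5.3] [cite: SilvermanAEC2009, VII.5 Prop. 5.1(b)] -/
theorem padicValRat_j_nonneg_of_pStar_pair_addv {p : ℕ} [Fact p.Prime] (hp2 : p ≠ 2)
    {W W' : WeierstrassCurve ℚ} [W.IsElliptic] [W'.IsElliptic] (u : VariableChange ℚ)
    (hu : u • W.quadraticTwist ((((-1 : ℤ) ^ (p / 2) * p : ℤ)) : ℚ) = W')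
    (hW : Addv W p) (hW' : Addv W' p) : 0 ≤ padicValRat p W.j := by
  by_contra hj
  push Not at hj
  have hpm : AdditivePotMult.PotMult W p := ⟨hW, hj⟩
  have hm := hpm.mult_quadraticTwist_pStar hp2
  have hd0 : ((-1 : ℚ) ^ (p / 2) * p) ≠ 0 :=
    mul_ne_zero (pow_ne_zero _ (by norm_num)) (by exact_mod_cast (Fact.out : p.Prime).ne_zero)
  have hm' : Mult W' p :=
    AdditivePotMult.mult_of_model_twist hd0 hm ⟨u, by rw [← upperAnchor_pStar_cast]; exact hu⟩
  exact hW'.2 hm'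

/-- `j` is constant along a commuting `χ_d`-pair: `j(u • (W ⊗ χ_d)) = j(W)`.
[cite: SilvermanAEC2009, X.5 Cor. 5.4 and III.1 Prop. 1.4(b)] -/
theorem j_eq_of_smul_quadraticTwist_eq {W W' : WeierstrassCurve ℚ} [W.IsElliptic] [W'.IsElliptic]
    {d : ℚ} (hd : d ≠ 0) (u : VariableChange ℚ) (hu : u • W.quadraticTwist d = W') :
    W'.j = W.j := by
  haveI := W.isElliptic_quadraticTwist hd
  subst hu
  rw [variableChange_j, W.j_quadraticTwist hd]

/-- A place `v` of `ℤ` with `natGenerator v = p` IS the place `placeOf p`. [folklore] -/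
theorem eq_placeOf_of_natGenerator_eq {p : ℕ} [Fact p.Prime] (v : HeightOneSpectrum ℤ)
    (hv : natGenerator v = p) : v = placeOf p := by
  have h : primesEquiv (R := ℤ) v = ⟨p, Fact.out⟩ := Subtype.ext hv
  unfold placeOf
  rw [← h, Equiv.symm_apply_apply]

/-- **The UPPER member of a commuting `χ_{p*}`-pair at `p ≥ 5` with both members additive has no
`Iₙ*` fibre at `p`.** For `u • (W ⊗ χ_{p*}) = W'`, `W, W'` globally minimal and additive at `p ≥ 5`,
`ord_p Δ_min(W') = ord_p Δ_min(W) + 6`: the Kodaira symbol of `W'` at `p` is not `Iₙ*` for any `n`.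
For `n ≥ 1`, `Iₙ*` is potentially multiplicative (`ord_p j = −n < 0`, Silverman *ATAEC* IV Table 4.1,
tree `one_lt_valuation_j_of_kodairaSymbolAt_eq_Istar_succ`) while `j(W') = j(W)` has
`ord_p j ≥ 0` (§1); for `n = 0`, `ord_p Δ_min(W') = 6` (Table 4.1: `I₀* ↦ m + 1 = 6` at an additive
`p ≥ 5`) would force `ord_p Δ_min(W) = 0`, impossible at an additive prime (`ord_p Δ_min = m_p + 1 ≥ 2`).
[cite: SilvermanATAEC1994, IV Table 4.1 (PDF p. 365) and IV.9.4 Step 7] -/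
theorem kodairaSymbolAt_ne_Istar_of_upper {p : ℕ} [Fact p.Prime] (h5 : 5 ≤ p)
    {W W' : WeierstrassCurve ℚ} [W.IsElliptic] [W.IsGloballyMinimal] [W'.IsElliptic]
    [W'.IsGloballyMinimal] (u : VariableChange ℚ)
    (hu : u • W.quadraticTwist ((((-1 : ℤ) ^ (p / 2) * p : ℤ)) : ℚ) = W')
    (hW : Addv W p) (hW' : Addv W' p)
    (hΔ : padicValInt p W'.minimalDiscriminantInt = padicValInt p W.minimalDiscriminantInt + 6)
    (v : HeightOneSpectrum ℤ) (n : ℕ) (hv : natGenerator v = p) :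
    W'.kodairaSymbolAt v ≠ .Istar n := by
  have hp : p.Prime := Fact.out
  have hp2 : p ≠ 2 := by omega
  obtain rfl := eq_placeOf_of_natGenerator_eq v hv
  intro hk
  have hvW := padicValInt_minimalDiscriminantInt_eq_numComponents_add_one W p h5 hW
  have hvW' := padicValInt_minimalDiscriminantInt_eq_numComponents_add_one W' p h5 hW'
  cases n with
  | zero =>
    rw [hk] at hvW'
    simp only [KodairaSymbol.numComponents] at hvW'
    omega
  | succ k =>
    have hchar : ringChar (ℤ ⧸ (placeOf p).asIdeal) ≠ 2 := by
      rw [ringChar_int_quot_placeOf p]; exact hp2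
    have h1 := one_lt_valuation_j_of_kodairaSymbolAt_eq_Istar_succ (placeOf p) W' hchar hk
    have hgen : natGenerator (placeOf p) = p := natGenerator_placeOf_eq p
    have hj0 : W'.j ≠ 0 := by
      intro h0
      rw [h0, map_zero] at h1
      exact not_lt.mpr zero_le_one h1
    rw [Rat.HeightOneSpectrum.valuation_eq_exp_neg_padicValRat (placeOf p) hj0, hgen,
      ← WithZero.exp_zero, WithZero.exp_lt_exp] at h1
    have hd0 : ((((-1 : ℤ) ^ (p / 2) * p : ℤ)) : ℚ) ≠ 0 := by
      rw [upperAnchor_pStar_cast]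
      exact mul_ne_zero (pow_ne_zero _ (by norm_num)) (by exact_mod_cast hp.ne_zero)
    have hj := padicValRat_j_nonneg_of_pStar_pair_addv hp2 u hu hW hW'
    rw [← j_eq_of_smul_quadraticTwist_eq hd0 u hu] at hj
    linarith

/-- **The upper member is of STARRED type: `ord_p Δ_min(W') ∈ {8, 9, 10}` (Kodaira IV*, III*, II*)**
— at an additive `p ≥ 5`, `ord_p Δ_min(W) ≥ 2`, so `ord_p Δ_min(W') = ord_p Δ_min(W) + 6 ≥ 8`, and
`ord_p Δ_min ≤ 10` off the types `Iₙ*` (Silverman *ATAEC* IV Table 4.1). In particular the Kodaira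
symbol of `W'` at `p` is none of II, III, IV (Edixhoven's exceptional types) and `4 < ord_p Δ_min(W')`.
[cite: SilvermanATAEC1994, IV Table 4.1 (PDF p. 365)] -/
theorem kodairaSymbolAt_upper_starred {p : ℕ} [Fact p.Prime] (h5 : 5 ≤ p)
    {W W' : WeierstrassCurve ℚ} [W.IsElliptic] [W.IsGloballyMinimal] [W'.IsElliptic]
    [W'.IsGloballyMinimal] (u : VariableChange ℚ)
    (hu : u • W.quadraticTwist ((((-1 : ℤ) ^ (p / 2) * p : ℤ)) : ℚ) = W')
    (hW : Addv W p) (hW' : Addv W' p)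
    (hΔ : padicValInt p W'.minimalDiscriminantInt = padicValInt p W.minimalDiscriminantInt + 6) :
    (W'.kodairaSymbolAt (placeOf p) = .IVstar ∧ padicValInt p W'.minimalDiscriminantInt = 8) ∨
    (W'.kodairaSymbolAt (placeOf p) = .IIIstar ∧ padicValInt p W'.minimalDiscriminantInt = 9) ∨
    (W'.kodairaSymbolAt (placeOf p) = .IIstar ∧ padicValInt p W'.minimalDiscriminantInt = 10) := by
  have hvW := padicValInt_minimalDiscriminantInt_eq_numComponents_add_one W p h5 hW
  rcases kodairaSymbolAt_placeOf_cases_of_addv W' p h5 hW' with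
    ⟨-, hv⟩ | ⟨-, hv⟩ | ⟨-, hv⟩ | ⟨n, hk, -⟩ | h | h | h
  · omega
  · omega
  · omega
  · exact absurd hk (kodairaSymbolAt_ne_Istar_of_upper h5 u hu hW hW' hΔ (placeOf p) n
      (natGenerator_placeOf_eq p))
  · exact Or.inl h
  · exact Or.inr (Or.inl h)
  · exact Or.inr (Or.inr h)

/-! ## §2 `p > 7`: the upper anchor is Edixhoven 1991, Thm. 3 (cite-only fact) -/

/-- **STUB 3 `stub_upperAnchor` at `p > 7`, GRANTED Edixhoven 1991 Thm. 3** in the tree's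
Kodaira-type rendering `edixhoven_not_dvd_maninConstant_of_kodairaSymbol_ne` (cite-only Literature
fact, NOT a hypothesis of crux C5 — so this is a conditional result, recorded as such): for a
commuting `χ_{p*}`-pair `u • (W ⊗ χ_{p*}) = W'` of globally minimal curves at a common conductor
`N`, `p² ∣ N`, `7 < p`, with `W'` the UPPER member (`ord_p Δ_min(W') = ord_p Δ_min(W) + 6`), every
lattice-optimal conductor-level datum `D'` of `W'` has `p ∤ c(D')`. Proof: both members are
additive at `p` (`p² ∣ N`), so by §1 the Kodaira symbol of `W'` at `p` is IV*, III* or II* — none of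
Edixhoven's exceptional types II, III, IV — and the fact applies verbatim to `(W', D')`. The
hypotheses `exists_isNewformOf`, `D`, `IsLatticeOptimal D`, `W[p]` irreducible of the registered
stub are carried and unused here. [cite: EdixhovenManin1991, Thm. 3]
[cite: SilvermanATAEC1994, IV Table 4.1] -/
theorem upperAnchor_of_edixhovenKodairaFact
    (hEd : edixhoven_not_dvd_maninConstant_of_kodairaSymbol_ne) :
    exists_isNewformOf →
    ∀ {p : ℕ}, p.Prime → 7 < p →
    ∀ (W W' : WeierstrassCurve ℚ) [W.IsElliptic] [W.IsGloballyMinimal] [W'.IsElliptic]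
      [W'.IsGloballyMinimal] [NeZero (W.conductorNorm ℤ)] [NeZero (W'.conductorNorm ℤ)]
      (u : VariableChange ℚ) (D : ModularParametrizationData W (W.conductorNorm ℤ))
      (D' : ModularParametrizationData W' (W'.conductorNorm ℤ)),
      IsLatticeOptimal D → IsLatticeOptimal D' →
      p ^ 2 ∣ W.conductorNorm ℤ → W'.conductorNorm ℤ = W.conductorNorm ℤ →
      u • W.quadraticTwist ((((-1 : ℤ) ^ (p / 2) * p : ℤ)) : ℚ) = W' →
      W.HasIrreducibleModPGaloisRep p →
      padicValInt p W'.minimalDiscriminantInt = padicValInt p W.minimalDiscriminantInt + 6 →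
      ¬ (p : ℤ) ∣ D'.maninConstant := by
  intro _ p hp h7 W W' _ _ _ _ _ _ u _ D' _ hD' hpN hNN hu _ hΔ
  haveI : Fact p.Prime := ⟨hp⟩
  have h5 : 5 ≤ p := by omega
  have hW : Addv W p := not_good_and_not_mult_of_sq_dvd_conductorNorm W hpN
  have hW' : Addv W' p :=
    not_good_and_not_mult_of_sq_dvd_conductorNorm W' (by rw [hNN]; exact hpN)
  have hst := kodairaSymbolAt_upper_starred h5 u hu hW hW' hΔ
  have hII : W'.kodairaSymbolAt (placeOf p) ≠ .II := by
    rcases hst with ⟨h, -⟩ | ⟨h, -⟩ | ⟨h, -⟩ <;> rw [h] <;> decide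
  have hIII : W'.kodairaSymbolAt (placeOf p) ≠ .III := by
    rcases hst with ⟨h, -⟩ | ⟨h, -⟩ | ⟨h, -⟩ <;> rw [h] <;> decide
  have hIV : W'.kodairaSymbolAt (placeOf p) ≠ .IV := by
    rcases hst with ⟨h, -⟩ | ⟨h, -⟩ | ⟨h, -⟩ <;> rw [h] <;> decide
  exact hEd W' D' hD' p hp h7 hII hIII hIV

/-! ## §3 `p ∈ {5, 7}`: the upper anchor is crux K★ `StarredOptimalManinUnitFiveSeven` -/

/-- **STUB 3 `stub_upperAnchor` at `p ∈ {5, 7}`, GRANTED crux K★ `StarredOptimalManinUnitFiveSeven`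
(stmt-BirchSwinnertonDyer-22226, route `EdixhovenFibreFiveSeven`; hypothesis `hK` = its body
VERBATIM, so that this file imports no route file — the by-name link is the companion file
`ManinLocalTwoThreeManinPrimeToAdditiveFiveLeUpperAnchorOfKStar`).** The upper member `W'`
of a commuting `χ_{p*}`-pair at a common conductor divisible by `p²`, `p ∈ {5, 7}`, `W[p]`
irreducible, meets every hypothesis of K★: additive at `p` (`p² ∣ N(W') = N(W)`), `W'[p]`
irreducible (irreducibility is invariant under `ℚ`-isomorphism and quadratic twist,
`AdditivePotMult.irr_iff_of_model_twist`), NO `Iₙ*` fibre at `p` (§1,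
`kodairaSymbolAt_ne_Istar_of_upper`), `4 < ord_p Δ_min(W') = ord_p Δ_min(W) + 6`, and `D'`
lattice-optimal at the conductor level; K★ then gives `p ∤ c(D')`. Conditional on K★ (an OPEN crux
of a sibling route, itself reduced to Kato's Néron integrality by
`starredOptimalManinUnitFiveSeven_of_kato`, p581141). [cite: EdixhovenManin1991, §1 and Thm. 3]
[cite: SilvermanATAEC1994, IV Table 4.1] -/
theorem upperAnchor_fiveSeven_of_starred
    (hK : ∀ (W : WeierstrassCurve ℚ) [W.IsElliptic] [W.IsGloballyMinimal] (p : ℕ) [Fact p.Prime]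
      [NeZero (W.conductorNorm ℤ)] (D : ModularParametrizationData W (W.conductorNorm ℤ)),
      (p = 5 ∨ p = 7) → Addv W p → Irr W p →
      (∀ (v : HeightOneSpectrum ℤ) (n : ℕ), natGenerator v = p → W.kodairaSymbolAt v ≠ .Istar n) →
      4 < padicValInt p W.minimalDiscriminantInt →
      (∀ z ∈ D.L.lattice, ∃ w ∈ periodLattice D.f, z = D.c * w) → ¬ (p : ℤ) ∣ D.c) :
    exists_isNewformOf →
    ∀ {p : ℕ}, p.Prime → (p = 5 ∨ p = 7) →
    ∀ (W W' : WeierstrassCurve ℚ) [W.IsElliptic] [W.IsGloballyMinimal] [W'.IsElliptic]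
      [W'.IsGloballyMinimal] [NeZero (W.conductorNorm ℤ)] [NeZero (W'.conductorNorm ℤ)]
      (u : VariableChange ℚ) (D : ModularParametrizationData W (W.conductorNorm ℤ))
      (D' : ModularParametrizationData W' (W'.conductorNorm ℤ)),
      IsLatticeOptimal D → IsLatticeOptimal D' →
      p ^ 2 ∣ W.conductorNorm ℤ → W'.conductorNorm ℤ = W.conductorNorm ℤ →
      u • W.quadraticTwist ((((-1 : ℤ) ^ (p / 2) * p : ℤ)) : ℚ) = W' →
      W.HasIrreducibleModPGaloisRep p →
      padicValInt p W'.minimalDiscriminantInt = padicValInt p W.minimalDiscriminantInt + 6 →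
      ¬ (p : ℤ) ∣ D'.maninConstant := by
  intro _ p hp h57 W W' _ _ _ _ _ _ u _ D' _ hD' hpN hNN hu hirr hΔ
  haveI : Fact p.Prime := ⟨hp⟩
  have h5 : 5 ≤ p := by rcases h57 with rfl | rfl <;> norm_num
  have hd0 : ((((-1 : ℤ) ^ (p / 2) * p : ℤ)) : ℚ) ≠ 0 := by
    rw [upperAnchor_pStar_cast]
    exact mul_ne_zero (pow_ne_zero _ (by norm_num)) (by exact_mod_cast hp.ne_zero)
  have hW : Addv W p := not_good_and_not_mult_of_sq_dvd_conductorNorm W hpN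
  have hW' : Addv W' p :=
    not_good_and_not_mult_of_sq_dvd_conductorNorm W' (by rw [hNN]; exact hpN)
  have hirr' : Irr W' p := (AdditivePotMult.irr_iff_of_model_twist hd0 ⟨u, hu⟩).mpr hirr
  have h4 : 4 < padicValInt p W'.minimalDiscriminantInt := by omega
  exact hK W' p D' h57 hW' hirr'
    (fun v n hv ↦ kodairaSymbolAt_ne_Istar_of_upper h5 u hu hW hW' hΔ v n hv) h4 hD'

/-! ## §4 Assembly: STUB 3 verbatim, modulo the two named statements -/

/-- **STUB 3 `stub_upperAnchor` of line `upper_anchor` (crux C5 `ManinPrimeToAdditiveFiveLe`,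
stmt-BirchSwinnertonDyer-22969) — its REGISTERED signature verbatim as the conclusion — GRANTED
(i) Edixhoven 1991 Thm. 3 in Kodaira-type form (`edixhoven_not_dvd_maninConstant_of_kodairaSymbol_ne`,
cite-only Literature fact) and (ii) crux K★ `StarredOptimalManinUnitFiveSeven` (stmt-22226; `hK` =
its body verbatim).**
A prime `p ≥ 5` is `5`, `7` or `> 7`; §3 resp. §2. HONEST STATUS: conditional-result — the stub's
own signature is NOT proved; inside C5-as-typed (whose hypotheses are the printed semistable facts
and modularity only) input (i) is a re-proof of Edixhoven's theorem (XL) and input (ii) is open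
mathematics at `(5, II*)` (`e = 6 > p − 1`). BSD is not proved by this; C5 is not proved by this.
[cite: EdixhovenManin1991, Thm. 3] -/
theorem upperAnchor_of_edixhovenKodairaFact_of_starred
    (hEd : edixhoven_not_dvd_maninConstant_of_kodairaSymbol_ne)
    (hK : ∀ (W : WeierstrassCurve ℚ) [W.IsElliptic] [W.IsGloballyMinimal] (p : ℕ) [Fact p.Prime]
      [NeZero (W.conductorNorm ℤ)] (D : ModularParametrizationData W (W.conductorNorm ℤ)),
      (p = 5 ∨ p = 7) → Addv W p → Irr W p →
      (∀ (v : HeightOneSpectrum ℤ) (n : ℕ), natGenerator v = p → W.kodairaSymbolAt v ≠ .Istar n) →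
      4 < padicValInt p W.minimalDiscriminantInt →
      (∀ z ∈ D.L.lattice, ∃ w ∈ periodLattice D.f, z = D.c * w) → ¬ (p : ℤ) ∣ D.c) :
    exists_isNewformOf →
    ∀ {p : ℕ}, p.Prime → 5 ≤ p →
    ∀ (W W' : WeierstrassCurve ℚ) [W.IsElliptic] [W.IsGloballyMinimal] [W'.IsElliptic]
      [W'.IsGloballyMinimal] [NeZero (W.conductorNorm ℤ)] [NeZero (W'.conductorNorm ℤ)]
      (u : VariableChange ℚ) (D : ModularParametrizationData W (W.conductorNorm ℤ))
      (D' : ModularParametrizationData W' (W'.conductorNorm ℤ)),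
      IsLatticeOptimal D → IsLatticeOptimal D' →
      p ^ 2 ∣ W.conductorNorm ℤ → W'.conductorNorm ℤ = W.conductorNorm ℤ →
      u • W.quadraticTwist ((((-1 : ℤ) ^ (p / 2) * p : ℤ)) : ℚ) = W' →
      W.HasIrreducibleModPGaloisRep p →
      padicValInt p W'.minimalDiscriminantInt = padicValInt p W.minimalDiscriminantInt + 6 →
      ¬ (p : ℤ) ∣ D'.maninConstant := by
  intro hnf p hp h5 W W' _ _ _ _ _ _ u D D' hD hD' hpN hNN hu hirr hΔ
  by_cases h7 : 7 < p
  · exact upperAnchor_of_edixhovenKodairaFact hEd hnf hp h7 W W' u D D' hD hD' hpN hNN hu hirr hΔ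
  · have h6 : p ≠ 6 := by rintro rfl; exact absurd hp (by decide)
    have h57 : p = 5 ∨ p = 7 := by omega
    exact upperAnchor_fiveSeven_of_starred hK hnf hp h57 W W' u D D' hD hD' hpN hNN hu hirr hΔ

end Summit.BirchSwinnertonDyer.BirchSwinnertonDyer.Theorems

end
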